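import Literature.MathematicalPhysics.QuantumLattice.ClusterProductStates
import Literature.MathematicalPhysics.QuantumLattice.HubbardBondAlgebra
import Literature.MathematicalPhysics.QuantumLattice.HubbardNNNHoppingOpenClusters
import HarnessLib

/-!
# Cluster trial states for the pinning-field rows, part 1: the partition of the `L × L` fermionic
# torus into translated open `a × b` blocks

HONEST FRAMING: first certified bounds; not a superconductivity verdict; every number certified or
labelled float. Nothing in this file is a number: it is finite-torus bookkeeping for cluster trial states.

Cell hubbard-obs / hubbard-cq (D-0082 (c), LADDER row PC-a "pinning-field response"; seat hubbard-obs-pin-1,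
the `q`-slot of the sourced energy CEILING cell `SourcedEnergyUpperRow tp U μ h q L₀ e` of
`Rows/SourcedTorusRows.lean`: "trial states tiling the torus by blocks give `q ∣ L`"). For block sides
`a, b` and block counts `Kx, Ky` with `L = Kx · a = Ky · b`, the torus `Λ_L = FermionTorus 2 L =
Lex (Fin 2 → Fin L)` is the disjoint union of the `Kx · Ky` translates `(R₁ a, R₂ b) + [0,a) × [0,b)`,
`R ∈ Fin Kx ×ₗ Fin Ky`. This file realises them as an ORDERED PARTITION of the orbital set `Orb Λ_L` in
the sense of the tree's `ClusterProduct.Partition` (`ClusterProductStates`), with cluster site type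
`Fin a ×ₗ Fin b` — the vertex set of the tree's open cluster `rectBoxGraph a b`
(`HubbardNNNHoppingOpenClusters`) — so that the Koszul-signed product states `⊗_R ψ_R` of cluster
vectors (`prodFamily`) and the locality of even cluster operators (`jwEmbed_mulVec_prodFamily`) become
available for cluster trial states of the particle-number NON-conserving pair-sourced torus
`dWaveSourceTorus` (parts 2–4: `TorusRectBlockNoWrap`, `DWaveSourceOpenClusterCut`,
`DWaveSourceOpenClusterCap`). It is the `a × b` twin of the tree's `TorusPlaquettePartition`
(the `2 × 2` case):

* `blockSite hLa hLb R p = (R₁ a + p₁, R₂ b + p₂)`, strictly monotone in `p` for the lexicographic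
  orders (`blockSite_strictMono`), the order embeddings `blockSiteEmb`, `blockOrbEmb = orbEmb ∘ …`;
* `blockOf x = (x₀ / a, x₁ / b)`, `posOf x = (x₀ % a, x₁ % b)` and the partition
  **`rectBlockPartition hLa hLb : Partition (Orb Λ_L) (Fin Kx ×ₗ Fin Ky) (Orb (Fin a ×ₗ Fin b))`**;
* disjointness and covering of the block images (`blockSite_ne_of_ne`,
  `biUnion_map_blockSiteEmb_eq_univ`), `card_blocks`.

References: D. Ruelle, *Statistical Mechanics: Rigorous Results* (1969), §2.2, §3.3 (boxes and
sub-boxes; the cluster variational principle); O. Bratteli, D. W. Robinson, *Operator Algebras and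
QSM II* (1997) §5.2.2 (CAR algebra of a direct sum); W.-F. Tsai, S. A. Kivelson, PRB 73 (2006) 214510,
App. A (product states over plaquettes). Tree: `TorusPlaquettePartition` (pattern), `orbEmb`
(`HubbardBondAlgebra`), `rectBoxGraph` (`HubbardNNNHoppingOpenClusters`).
-/

noncomputable section

namespace Summit.Ventures.CertifiedManyBodySolver

open Matrix Finset Literature.Probability.LatticeModels
open Literature.MathematicalPhysics.QuantumLattice Literature.MathematicalPhysics.QuantumLattice.ThermodynamicLimit

namespace TorusRectBlock

variable {L Kx Ky a b : ℕ}

/-! ### Arithmetic of block coordinates -/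

/-- `R s + p < K s` for `R < K`, `p < s`. [folklore] -/
theorem mul_add_lt_of_eq {K s : ℕ} (hL : L = K * s) (R : Fin K) (p : Fin s) :
    (R : ℕ) * s + (p : ℕ) < L := by
  have h1 : ((R : ℕ) + 1) * s ≤ K * s := Nat.mul_le_mul_right s (Nat.succ_le_of_lt R.isLt)
  have h2 := p.isLt
  rw [Nat.add_mul, one_mul] at h1
  omega

/-- `x < K s ⇒ x / s < K` (in particular `s ≠ 0`). [folklore] -/
theorem div_lt_of_lt_mul {x K s : ℕ} (h : x < K * s) : x / s < K :=
  (Nat.div_lt_iff_lt_mul (Nat.pos_of_ne_zero fun h0 => by simp [h0] at h)).2 h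

/-- `x < K s ⇒ x % s < s`. [folklore] -/
theorem mod_lt_of_lt_mul {x K s : ℕ} (h : x < K * s) : x % s < s :=
  Nat.mod_lt _ (Nat.pos_of_ne_zero fun h0 => by simp [h0] at h)

/-- A block side is positive as soon as the torus has a site (`L = K s`, `L ≠ 0`). [folklore] -/
theorem side_pos_of_eq {K s : ℕ} [NeZero L] (hL : L = K * s) : 0 < s :=
  Nat.pos_of_ne_zero fun h0 => NeZero.ne L (by rw [hL, h0, mul_zero])

/-! ### Block sites -/

/-- The site `(R₁ a + p₁, R₂ b + p₂)` of the block `R = (R₁, R₂)` at position `p = (p₁, p₂)`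
(`L = Kx a = Ky b`). [cite: Ruelle1969, §3.3] -/
def blockSite (hLa : L = Kx * a) (hLb : L = Ky * b) (R : Fin Kx ×ₗ Fin Ky) (p : Fin a ×ₗ Fin b) :
    FermionTorus 2 L :=
  toLex ![⟨((ofLex R).1 : ℕ) * a + ((ofLex p).1 : ℕ), mul_add_lt_of_eq hLa _ _⟩,
    ⟨((ofLex R).2 : ℕ) * b + ((ofLex p).2 : ℕ), mul_add_lt_of_eq hLb _ _⟩]

variable (hLa : L = Kx * a) (hLb : L = Ky * b)

/-- First coordinate of a block site. [folklore] -/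
@[simp] theorem blockSite_apply_zero (R : Fin Kx ×ₗ Fin Ky) (p : Fin a ×ₗ Fin b) :
    ((ofLex (blockSite hLa hLb R p)) 0 : ℕ) = ((ofLex R).1 : ℕ) * a + ((ofLex p).1 : ℕ) := rfl

/-- Second coordinate of a block site. [folklore] -/
@[simp] theorem blockSite_apply_one (R : Fin Kx ×ₗ Fin Ky) (p : Fin a ×ₗ Fin b) :
    ((ofLex (blockSite hLa hLb R p)) 1 : ℕ) = ((ofLex R).2 : ℕ) * b + ((ofLex p).2 : ℕ) := rfl

/-- **`p ↦ blockSite R p` is strictly monotone** (lexicographic orders on `Fin a ×ₗ Fin b` and on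
`Lex (Fin 2 → Fin L)`, first coordinate major in both). [folklore] -/
theorem blockSite_strictMono (R : Fin Kx ×ₗ Fin Ky) : StrictMono (blockSite hLa hLb R) := by
  intro p q hpq
  rcases Prod.Lex.lt_iff.1 hpq with h | ⟨h1, h2⟩
  · refine ⟨0, fun j hj => absurd hj (Fin.not_lt_zero j), ?_⟩
    show ((ofLex (blockSite hLa hLb R p)) 0 : ℕ) < ((ofLex (blockSite hLa hLb R q)) 0 : ℕ)
    rw [blockSite_apply_zero, blockSite_apply_zero]
    have h' : ((ofLex p).1 : ℕ) < ((ofLex q).1 : ℕ) := h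
    omega
  · refine ⟨1, fun j hj => ?_, ?_⟩
    · have hj0 : j = 0 := by
        rcases Fin.eq_zero_or_eq_succ j with h0 | ⟨k, hk⟩
        · exact h0
        · exfalso
          have : (j : ℕ) < 1 := hj
          rw [hk] at this
          simp at this
      subst hj0
      apply Fin.ext
      change ((ofLex (blockSite hLa hLb R p)) 0 : ℕ) = ((ofLex (blockSite hLa hLb R q)) 0 : ℕ)
      rw [blockSite_apply_zero, blockSite_apply_zero, h1]
    · show ((ofLex (blockSite hLa hLb R p)) 1 : ℕ) < ((ofLex (blockSite hLa hLb R q)) 1 : ℕ)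
      rw [blockSite_apply_one, blockSite_apply_one]
      have h' : ((ofLex p).2 : ℕ) < ((ofLex q).2 : ℕ) := h2
      omega

/-- The block `R` as an order embedding of sites. [folklore] -/
def blockSiteEmb (R : Fin Kx ×ₗ Fin Ky) : (Fin a ×ₗ Fin b) ↪o FermionTorus 2 L :=
  OrderEmbedding.ofStrictMono _ (blockSite_strictMono hLa hLb R)

/-- `blockSiteEmb` is `blockSite`. [folklore] -/
@[simp] theorem blockSiteEmb_apply (R : Fin Kx ×ₗ Fin Ky) (p : Fin a ×ₗ Fin b) :
    blockSiteEmb hLa hLb R p = blockSite hLa hLb R p := rfl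

/-- The block `R` as an order embedding of ORBITALS, `(p, σ) ↦ (blockSite R p, σ)`. [folklore] -/
def blockOrbEmb (R : Fin Kx ×ₗ Fin Ky) : Orb (Fin a ×ₗ Fin b) ↪o Orb (FermionTorus 2 L) :=
  orbEmb (blockSiteEmb hLa hLb R)

/-- `blockOrbEmb` on an orbital. [folklore] -/
@[simp] theorem blockOrbEmb_orb (R : Fin Kx ×ₗ Fin Ky) (p : Fin a ×ₗ Fin b) (σ : Fin 2) :
    blockOrbEmb hLa hLb R (orb p σ) = orb (blockSite hLa hLb R p) σ := rfl

/-! ### The block and the position of a site -/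

/-- The block of a site: `x ↦ (x₀ / a, x₁ / b)`. [folklore] -/
def blockOf (x : FermionTorus 2 L) : Fin Kx ×ₗ Fin Ky :=
  toLex (⟨((ofLex x) 0 : ℕ) / a, div_lt_of_lt_mul (lt_of_lt_of_eq ((ofLex x) 0).isLt hLa)⟩,
    ⟨((ofLex x) 1 : ℕ) / b, div_lt_of_lt_mul (lt_of_lt_of_eq ((ofLex x) 1).isLt hLb)⟩)

/-- The position of a site inside its block: `x ↦ (x₀ % a, x₁ % b)`. [folklore] -/
def posOf (x : FermionTorus 2 L) : Fin a ×ₗ Fin b :=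
  toLex (⟨((ofLex x) 0 : ℕ) % a, mod_lt_of_lt_mul (lt_of_lt_of_eq ((ofLex x) 0).isLt hLa)⟩,
    ⟨((ofLex x) 1 : ℕ) % b, mod_lt_of_lt_mul (lt_of_lt_of_eq ((ofLex x) 1).isLt hLb)⟩)

/-- Coordinates of `blockOf`. [folklore] -/
@[simp] theorem blockOf_fst (x : FermionTorus 2 L) : (((ofLex (blockOf hLa hLb x)).1 : Fin Kx) : ℕ) = ((ofLex x) 0 : ℕ) / a := rfl

/-- Coordinates of `blockOf`. [folklore] -/
@[simp] theorem blockOf_snd (x : FermionTorus 2 L) : (((ofLex (blockOf hLa hLb x)).2 : Fin Ky) : ℕ) = ((ofLex x) 1 : ℕ) / b := rfl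

/-- Coordinates of `posOf`. [folklore] -/
@[simp] theorem posOf_fst (x : FermionTorus 2 L) : (((ofLex (posOf hLa hLb x)).1 : Fin a) : ℕ) = ((ofLex x) 0 : ℕ) % a := rfl

/-- Coordinates of `posOf`. [folklore] -/
@[simp] theorem posOf_snd (x : FermionTorus 2 L) : (((ofLex (posOf hLa hLb x)).2 : Fin b) : ℕ) = ((ofLex x) 1 : ℕ) % b := rfl

/-- Two torus sites with the same natural coordinates are equal. [folklore] -/
theorem site_ext {x y : FermionTorus 2 L} (h0 : ((ofLex x) 0 : ℕ) = ((ofLex y) 0 : ℕ))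
    (h1 : ((ofLex x) 1 : ℕ) = ((ofLex y) 1 : ℕ)) : x = y := by
  have : ofLex x = ofLex y := by
    funext i
    apply Fin.ext
    rcases Fin.eq_zero_or_eq_succ i with h | ⟨k, hk⟩
    · subst h; exact h0
    · have hk1 : k = 0 := Fin.eq_zero k
      subst hk1
      have : i = 1 := by rw [hk]; rfl
      subst this
      exact h1
  simpa using this

/-- `(x / a) a + x % a = x`: a site is the `posOf`-th site of its block. [folklore] -/
theorem blockSite_blockOf_posOf (x : FermionTorus 2 L) :
    blockSite hLa hLb (blockOf hLa hLb x) (posOf hLa hLb x) = x := by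
  apply site_ext
  · rw [blockSite_apply_zero]
    change ((ofLex x) 0 : ℕ) / a * a + ((ofLex x) 0 : ℕ) % a = _
    exact Nat.div_add_mod' _ _
  · rw [blockSite_apply_one]
    change ((ofLex x) 1 : ℕ) / b * b + ((ofLex x) 1 : ℕ) % b = _
    exact Nat.div_add_mod' _ _

/-- `(R a + p) / a = R`. [folklore] -/
theorem blockOf_blockSite (R : Fin Kx ×ₗ Fin Ky) (p : Fin a ×ₗ Fin b) :
    blockOf hLa hLb (blockSite hLa hLb R p) = R := by
  haveI : NeZero L := ⟨fun h0 => by have := mul_add_lt_of_eq hLa (ofLex R).1 (ofLex p).1; omega⟩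
  have ha : 0 < a := side_pos_of_eq hLa
  have hb : 0 < b := side_pos_of_eq hLb
  change toLex _ = R
  rw [← toLex_ofLex R]
  congr 1
  ext
  · change (((ofLex (blockSite hLa hLb R p)) 0 : ℕ)) / a = ((ofLex R).1 : ℕ)
    rw [blockSite_apply_zero, add_comm, Nat.add_mul_div_right _ _ ha, Nat.div_eq_of_lt (ofLex p).1.isLt,
      zero_add]
  · change (((ofLex (blockSite hLa hLb R p)) 1 : ℕ)) / b = ((ofLex R).2 : ℕ)
    rw [blockSite_apply_one, add_comm, Nat.add_mul_div_right _ _ hb, Nat.div_eq_of_lt (ofLex p).2.isLt,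
      zero_add]

/-- `(R a + p) % a = p`. [folklore] -/
theorem posOf_blockSite (R : Fin Kx ×ₗ Fin Ky) (p : Fin a ×ₗ Fin b) :
    posOf hLa hLb (blockSite hLa hLb R p) = p := by
  change toLex _ = p
  rw [← toLex_ofLex p]
  congr 1
  ext
  · change (((ofLex (blockSite hLa hLb R p)) 0 : ℕ)) % a = ((ofLex p).1 : ℕ)
    rw [blockSite_apply_zero, add_comm, Nat.add_mul_mod_self_right, Nat.mod_eq_of_lt (ofLex p).1.isLt]
  · change (((ofLex (blockSite hLa hLb R p)) 1 : ℕ)) % b = ((ofLex p).2 : ℕ)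
    rw [blockSite_apply_one, add_comm, Nat.add_mul_mod_self_right, Nat.mod_eq_of_lt (ofLex p).2.isLt]

/-! ### The partition -/

/-- **The `a × b` block partition of the `L`-torus** (`L = Kx a = Ky b`): clusters = blocks
`R : Fin Kx ×ₗ Fin Ky` (lexicographic order), internal orbitals `Orb (Fin a ×ₗ Fin b)`, embeddings
`blockOrbEmb`. [cite: Ruelle1969, §3.3] -/
def rectBlockPartition :
    ClusterProduct.Partition (Orb (FermionTorus 2 L)) (Fin Kx ×ₗ Fin Ky) (Orb (Fin a ×ₗ Fin b)) where
  emb R := blockOrbEmb hLa hLb R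
  cl o := blockOf hLa hLb (ofLex o).1
  idx o := orb (posOf hLa hLb (ofLex o).1) (ofLex o).2
  emb_cl_idx o := by
    change orb (blockSite hLa hLb (blockOf hLa hLb (ofLex o).1) (posOf hLa hLb (ofLex o).1)) (ofLex o).2 = o
    rw [blockSite_blockOf_posOf]
    rfl
  cl_emb R q := by
    change blockOf hLa hLb (blockSite hLa hLb R (ofLex q).1) = R
    exact blockOf_blockSite hLa hLb R _
  idx_emb R q := by
    change orb (posOf hLa hLb (blockSite hLa hLb R (ofLex q).1)) (ofLex q).2 = q
    rw [posOf_blockSite]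
    rfl

/-- The embeddings of the block partition. [folklore] -/
@[simp] theorem rectBlockPartition_emb (R : Fin Kx ×ₗ Fin Ky) :
    (rectBlockPartition hLa hLb).emb R = blockOrbEmb hLa hLb R := rfl

/-- The cluster of an orbital is the block of its site. [folklore] -/
@[simp] theorem rectBlockPartition_cl (o : Orb (FermionTorus 2 L)) :
    (rectBlockPartition hLa hLb).cl o = blockOf hLa hLb (ofLex o).1 := rfl

/-- The position of an orbital is (position of its site, its spin). [folklore] -/
@[simp] theorem rectBlockPartition_idx (o : Orb (FermionTorus 2 L)) :
    (rectBlockPartition hLa hLb).idx o = orb (posOf hLa hLb (ofLex o).1) (ofLex o).2 := rfl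

/-- Every orbital is the embedded (position, spin) of its block. [folklore] -/
theorem orb_eq_emb (x : FermionTorus 2 L) (σ : Fin 2) :
    orb x σ = (rectBlockPartition hLa hLb).emb (blockOf hLa hLb x) (orb (posOf hLa hLb x) σ) :=
  ((rectBlockPartition hLa hLb).emb_cl_idx (orb x σ)).symm

/-- Distinct blocks have disjoint site images. [folklore] -/
theorem blockSite_ne_of_ne {R R' : Fin Kx ×ₗ Fin Ky} (h : R ≠ R') (p q : Fin a ×ₗ Fin b) :
    blockSite hLa hLb R p ≠ blockSite hLa hLb R' q := by
  intro h'
  apply h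
  rw [← blockOf_blockSite hLa hLb R p, h', blockOf_blockSite]

/-- Sites of different blocks have different blocks (contrapositive bookkeeping). [folklore] -/
theorem blockOf_ne_of_blockSite {R R' : Fin Kx ×ₗ Fin Ky} (h : R ≠ R') (p q : Fin a ×ₗ Fin b) :
    blockOf hLa hLb (blockSite hLa hLb R p) ≠ blockOf hLa hLb (blockSite hLa hLb R' q) := by
  rwa [blockOf_blockSite, blockOf_blockSite]

/-- Every site lies in the image of its block: the block images cover the torus. [folklore] -/
theorem biUnion_map_blockSiteEmb_eq_univ :
    (Finset.univ.biUnion fun R : Fin Kx ×ₗ Fin Ky =>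
      (Finset.univ : Finset (Fin a ×ₗ Fin b)).map (blockSiteEmb hLa hLb R).toEmbedding) = Finset.univ := by
  ext x
  simp only [Finset.mem_biUnion, Finset.mem_univ, true_and, Finset.mem_map, RelEmbedding.coe_toEmbedding,
    blockSiteEmb_apply, iff_true]
  exact ⟨blockOf hLa hLb x, posOf hLa hLb x, blockSite_blockOf_posOf hLa hLb x⟩

/-- The number of blocks is `Kx · Ky`. [folklore] -/
theorem card_blocks : Fintype.card (Fin Kx ×ₗ Fin Ky) = Kx * Ky := by
  rw [Fintype.card_lex, Fintype.card_prod, Fintype.card_fin, Fintype.card_fin]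


end TorusRectBlock

end Summit.Ventures.CertifiedManyBodySolver

end
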